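import Summits.CriticalPhenomena.PercolationContinuityZ3.Theorems.PercNearOneGluingNoHeavyLowerTailSahiInterpCheck
import Summits.CriticalPhenomena.PercolationContinuityZ3.Theorems.PercNearOneGluingNoHeavyLowerTailSahiSymCubeSound

/-!
# The interpolation leaf test for Sahi's `E_n` on `{0,1}^m`, IV: invariance under the coordinate permutations

Support file (cell `prim-sahi`, seat `prim-sahi-typer` gen 30; `--supports stmt-CriticalPhenomena-4575`).  Pure proofs; standard axioms, no `sorry`.

* `encA_injective` — events of `Set (Fin m)` are determined by their bitmasks; **`pullN_encA`** — `pullN m σ (encA m X)` is the bitmask of the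
  pull-back event `{S | σ '' S ∈ X}` (…`SahiSymCubeOrbit.pt_actP`);
* `reindexOK_spec` — a passing `reindexOK` is a relabelling by a permutation of `Fin n`;
* **`sahiE_perm_of_symFam`** — if the bitmasks of `A` pass `symFam m n`, then `E_n(μ_{p∘σ}; A) = E_n(μ_p; A)` for every `σ ∈ Sym(Fin m)` and every
  product weight (transport `sahiE_comp_equiv` along `S ↦ σ⁻¹ '' S`, …`SahiSymCubeSound.bernoulliWeight_image_perm`, relabelling `sahiE_comp_perm`).
  This is what lets the checker evaluate `E_n` at SORTED grid points only. [this work]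
-/

namespace Summit.CriticalPhenomena.PercolationContinuityZ3.Theorems.SahiInterp

open Finset OneCutCert SahiC3Cube NCopyCert SahiSymCube

/-! ## Symmetry of a family under the coordinate permutations -/

open Literature.Combinatorics.Sahi2008 (sahiE bernoulliWeight sahiE_comp_perm sahiE_comp_equiv)
open Literature.Probability.Percolation.DecisionTree (ind ind_of_mem ind_of_not_mem)

/-- Event bitmasks determine events. [this work] -/
theorem encA_injective (m : ℕ) : Function.Injective (encA m) := by
  classical
  intro X Y h
  ext S
  have hb := congrArg (fun N => Nat.testBit N (encS S)) h
  simp only [testBit_encA, encS_lt S, decide_true, Bool.true_and] at hb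
  rw [pt_encS] at hb
  constructor
  · intro hS
    have h1 : decide (S ∈ Y) = true := by rw [← hb]; exact decide_eq_true hS
    exact of_decide_eq_true h1
  · intro hS
    have h1 : decide (S ∈ X) = true := by rw [hb]; exact decide_eq_true hS
    exact of_decide_eq_true h1

/-- **`pullN` is the bitmask of the pull-back event** `{S | σ '' S ∈ X}` along the coordinate permutation `σ`. [this work] -/
theorem pullN_encA {m : ℕ} (σ : Equiv.Perm (Fin m)) (X : Set (Set (Fin m))) :
    pullN m (List.ofFn fun i : Fin m => ((σ i : Fin m) : ℕ)) (encA m X) = encA m {S | σ '' S ∈ X} := by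
  refine Nat.eq_of_testBit_eq fun y => ?_
  unfold pullN
  rw [testBit_ofBits, testBit_encA, testBit_encA]
  by_cases hy : y < 2 ^ m
  · have h1 : actL m (List.ofFn fun i : Fin m => ((σ i : Fin m) : ℕ)) y = actP m σ y := rfl
    rw [h1, pt_actP]
    simp only [hy, decide_true, Bool.true_and, actP_lt, Set.mem_setOf_eq]
    apply Bool.eq_iff_iff.2
    simp only [decide_eq_true_eq]
  · simp [hy]

/-- A passing `reindexOK` yields a relabelling permutation. [this work] -/
theorem reindexOK_spec {n : ℕ} {a b : Fin n → ℕ} (h : reindexOK n a b = true) :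
    ∃ τ : Equiv.Perm (Fin n), ∀ i, a (τ i) = b i := by
  unfold reindexOK at h
  simp only [Bool.and_eq_true, decide_eq_true_eq] at h
  obtain ⟨hval, hinj⟩ := h
  exact ⟨Equiv.ofBijective _ (Finite.injective_iff_bijective.1 hinj), fun i => hval i⟩

/-- **`E_n(μ_p; A)` is invariant under the coordinate permutations** (weight `p ↦ p ∘ σ`) for a family whose bitmasks pass `symFam`. [this work] -/
theorem sahiE_perm_of_symFam {m n : ℕ} (A : Fin n → Set (Set (Fin m))) (hsym : symFam m n (fun i => encA m (A i)) = true)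
    (σ : Equiv.Perm (Fin m)) (p : Fin m → unitInterval) :
    sahiE (bernoulliWeight (p ∘ σ)) n (fun i => ind (A i)) = sahiE (bernoulliWeight p) n (fun i => ind (A i)) := by
  set σ' : Equiv.Perm (Fin m) := σ.symm with hσ'
  have hpσ : (p ∘ σ) = p ∘ σ'.symm := by rw [hσ', Equiv.symm_symm]
  -- the relabelling permutation from the check
  unfold symFam at hsym
  rw [List.all_eq_true] at hsym
  have hOK := hsym _ (ofFn_perm_mem_permsL σ')
  obtain ⟨τ, hτ⟩ := reindexOK_spec hOK
  have hA : ∀ i, A (τ i) = {S | σ' '' S ∈ A i} := by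
    intro i
    apply encA_injective m
    rw [hτ i, pullN_encA]
  -- transport along `S ↦ σ' '' S`
  have h := sahiE_comp_equiv (Equiv.Set.congr σ') (bernoulliWeight (p ∘ σ'.symm)) n (fun i => ind (A i))
  have hμ : (bernoulliWeight (p ∘ σ'.symm) ∘ (Equiv.Set.congr σ')) = bernoulliWeight p := by
    funext ω; exact bernoulliWeight_image_perm σ' p ω
  have hf : (fun i => ind (A i) ∘ (Equiv.Set.congr σ')) = fun i => ind (A (τ i)) := by
    funext i S
    show ind (A i) (σ' '' S) = ind (A (τ i)) S
    rw [hA i]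
    by_cases hS : σ' '' S ∈ A i
    · rw [ind_of_mem hS, ind_of_mem (show S ∈ {S | σ' '' S ∈ A i} from hS)]
    · rw [ind_of_not_mem hS, ind_of_not_mem (show S ∉ {S | σ' '' S ∈ A i} from hS)]
  rw [hμ, hf] at h
  rw [hpσ, ← h]
  exact sahiE_comp_perm (bernoulliWeight p) n τ (fun i => ind (A i))

end Summit.CriticalPhenomena.PercolationContinuityZ3.Theorems.SahiInterp
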